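import Literature.AnabelianGeometry.SemiGraphs.TemperedSpecialFibre
import Literature.AnabelianGeometry.SemiGraphs.TemperedCompactPreimage
import Literature.AnabelianGeometry.SemiGraphs.TemperedCurvesWitness
import HarnessLib

/-!
# [SemiAnbd] Rmk 3.10.1: the pro-`Σ` quotient datum `ProSigmaQuotient` is INHABITED (abc-iut L3
# inhabitation census v1, row `ProSigmaQuotient`: zero producers)

Mochizuki, *Semi-graphs of anabelioids*, Publ. RIMS **42** (2006), §3, Remark 3.10.1 (p. 45; PRIMS p. 271)
[cite: MochizukiSemiAnbd2006, Rmk 3.10.1 p.45]: the pro-`Σ` tempered fundamental groups `Π ↠ Π^Σ`,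
`Δ ↠ Δ^Σ`.  abc-iut-L3-t2's `ProfiniteSemiGraph`-side record `ProSigmaQuotient D Σ` (`TemperedSpecialFibre.lean`)
carries ONLY two closed normal subgroups `ker ≤ Π`, `kerDelta ≤ Δ` with `kerDelta ⊆ ker ∩ Δ`; the `Σ`-semantics
(«these ARE the pro-`Σ` kernels») is by design carried by the origin certificate `ProSigmaOrigin.IsProSigmaOf`
(SCHEMA-CLASS binder, audit L1-t10 F3).  Hence the record is inhabited at EVERY tempered arithmetic group:

* `ProSigmaQuotient.nonempty_trivialKernel D Σ` — the trivial-kernel datum `ker := ⊥`, `kerDelta := ⊥`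
  (closed because tempered groups are Hausdorff, abc-iut-L3's `IsTempered.t2Space`).  HONEST LABEL: this is
  the GENUINE pro-`Σ` datum exactly when `Π → Π^Σ` and `Δ → Δ^Σ` are injective (e.g. `Σ` = all primes and
  `Π`, `Δ` residually finite); for other `Σ` it is a formally admissible but non-geometric filling — which is
  all the record (without its origin certificate) can express;
* `ProSigmaQuotient.exists_model` — an outright instance over an algebraically closed field (abc-iut-L3's
  degenerate `TemperedArithmeticGroup.nonempty_of_isAlgClosed`, DEGENERATE: `Π = 1`).

PROOF-ONLY (no `def`/`instance`/`structure`); nothing here bears on [IUTchIII] Cor. 3.12.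
-/

namespace Literature.AnabelianGeometry.SemiGraphs

universe u

variable {K : Type u} [Field K]

/-- **Trivial-kernel pro-`Σ` datum** at any tempered arithmetic group `D` and any `Σ`: `ker := ⊥ ≤ Π`,
`kerDelta := ⊥ ≤ Δ` (closed: tempered groups are Hausdorff).  Genuine iff the pro-`Σ` quotient maps are
injective; see the module docstring. [cite: MochizukiSemiAnbd2006, Rmk 3.10.1 p.45] -/
theorem ProSigmaQuotient.nonempty_trivialKernel (D : TemperedArithmeticGroup K) (Sigma : Set ℕ) :
    Nonempty (ProSigmaQuotient D Sigma) := by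
  haveI : T2Space D.Pi := D.isTempered.t2Space
  refine ⟨{ ker := ⊥
            isClosed := by rw [Subgroup.coe_bot]; exact isClosed_singleton
            kerDelta := ⊥
            isClosed_kerDelta := by rw [Subgroup.coe_bot]; exact isClosed_singleton
            kerDelta_le := bot_le }⟩

/-- An outright instance of the pro-`Σ` record: over an algebraically closed field, at abc-iut-L3's
DEGENERATE tempered arithmetic group (`Π = G_K = 1`). DEGENERATE witness.
[cite: MochizukiSemiAnbd2006, Rmk 3.10.1 p.45] -/
theorem ProSigmaQuotient.exists_model (K : Type u) [Field K] [IsAlgClosed K] (Sigma : Set ℕ) :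
    ∃ D : TemperedArithmeticGroup K, Nonempty (ProSigmaQuotient D Sigma) := by
  obtain ⟨D⟩ := TemperedArithmeticGroup.nonempty_of_isAlgClosed K
  exact ⟨D, ProSigmaQuotient.nonempty_trivialKernel D Sigma⟩

end Literature.AnabelianGeometry.SemiGraphs
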